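/-
Copyright (c) 2026. All rights reserved.
Released under Apache 2.0 license as described in the file LICENSE.
Authors: abc-iut cell, statement-typer seat abc-iut-L4-t3 (wave 1); `⋉`-twin re-elaborated by prover seat abc-iut-L4-t11
(gen 15) per the cell recipe LTIMES-RECIPE (owner abc-iut-L4-t3), statements unchanged.
-/
import Literature.AnabelianGeometry.AbsoluteAnabelian.Ltimes.LogFrobeniusCorollaries
import Literature.AnabelianGeometry.AbsoluteAnabelian.LogFrobeniusContact
import HarnessLib

/-!
# [AbsTopIII] Corollary 5.5 (ii), generators of the contact structure `ℋ_{An•}` (pinned)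

S. Mochizuki, *Topics in absolute anabelian geometry III: global reconstruction algorithms*,
J. Math. Sci. Univ. Tokyo 22 (2015) 939–1156 [MochizukiAbsTopIII2015]; locators `p.N` = pages of the
author's manuscript (`paper:url-5493eb38cbb7`), read on the page: Cor 5.5 (ii) pp. 130–131.

`LogFrobeniusCorollaries.lean` (seat abc-iut-L4-t3) typed Cor 5.5 (ii) as `Cor55Telecore`: the telecore `𝔗_{An•}` with its
edges `φ_⋏ = φ_{An•}` PINNED, admitting SOME contact structure — the generators were left TODO(general form). This file
PINS them: over a telecore `T` on the core of Cor 5.5 (i) (`n = 6`, core vertex `An•[𝒳]`) and a family of homotopies `ℋ`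
on its underlying diagram `D_{An•}`, the predicate `IsAnContactGenerated T ℋ` records print's generators
`{η_{□⋎}, η_{□⋎}⁻¹, η_⋏, η_⋏⁻¹}`: "we write `η_{□⋎}` for the identity natural transformation from the arrow
`φ_□ : An•[𝒳] → 𝒳` to the composite arrow `id_⋎ ∘ φ_⋎ : An•[𝒳] → 𝒳`" and "`η_⋏ : (D_{An•})_{[β¹_⋏]} ⥲ (D_{An•})_{[β⁰_⋏]}` for the
isomorphism arising from `η_{An•}`", `[β⁰_⋏]` "the path on `Γ⃗_{D_{An•}}` of length `0` at `⋏`" and `[β¹_⋏]` "some … path on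
`Γ⃗_{D_{An•}}` of length `∈ {5, 6}` … that starts from `⋏`, descends via some path of length `∈ {4, 5}` to the core vertex
`An•[𝒳]`, and returns to `⋏` via the telecore edge `φ_⋏`"
(both pairs in both orders are boundary pairs; the homotopies are the printed ones componentwise, through the
datum `lamOver` — "`λ⊞_{v,ν}` lies over `Th•[Z]`" — and `η_{An•}` of the setting; the boundary set is GENERATED by these pairs,
Def 3.5 (ii)); `Cor55TelecoreContact` = Cor 5.5 (ii) with the contact structure so pinned. This is the input the second
sentence of Cor 5.5 (iv) and the telecore clause of Cor 5.5 (vi) need (they remain TODO(general form)). Every `Prop` is an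
ASSUMPTION on `L` asserted by the text for the genuine theaters. Refereed pre-IUT material; nothing here bears on [IUTchIII]
Cor. 3.12; typed ≠ discharged.

**`⋉`-TWIN (cell row «LTIMES-SUCCESSOR», L4-lead m162; typing finding T3g9-F1).**  This file is the verbatim
re-elaboration of `LogFrobeniusContact.lean` over the successor interface `LogFrobeniusSettingLtimes`
(`Ltimes/LogFrobeniusCompatibility.lean`: `ι⊞_{v,ε}` indexed by the edges of `Γ⃗^⋉_v` at EVERY place, [AbsTopIII] Cor 5.5 (iii)
p. 131), produced by the cell recipe `LTIMES-RECIPE.md`: names carry over inside `namespace LogFrobeniusSettingLtimes`, the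
section variable is `Lt`, setting-independent declarations are NOT repeated (the originals are in scope), statements and
proofs are otherwise unchanged.  The original file over the frozen interface stays as it is.
-/

set_option autoImplicit false

universe u

open CategoryTheory Quiver

namespace Literature.AnabelianGeometry.AbsoluteAnabelian

namespace LogFrobeniusSettingLtimes

variable {Vmod : Type u} {isArc : Vmod → Bool} (Lt : LogFrobeniusSettingLtimes Vmod isArc)

-- setting-independent declarations of the original file (namespace `LogFrobeniusSetting`) re-exposed under the
-- successor namespace (recipe rule 5); the originals are imported, not repeated.
export LogFrobeniusSetting (InFive core_mem_five row1_mem_five nplus_mem_five nv_mem_five e5_mem_five anTelecoreShape phiCorePath phiRowPath descendPath betaCorePath betaRowPath)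

/-- the underlying diagram of categories `D_{An•}` of the telecore, for telecore edges `J` realised by functors `tel`.
[cite: MochizukiAbsTopIII2015, Cor 5.5 (ii) p. 130] -/
abbrev anTelecoreDiagram (J : DSub (InFive (isArc := isArc)) → Type u)
    (tel : ∀ {a : DSub (InFive (isArc := isArc))}, J a → (Lt.An ⥤ a.1.categoryLtimes Lt)) :=
  (Lt.subdiagram InFive).extend (X := anTelecoreShape J) ⟨Lt.An, fun e => DEdge.functorLtimes Lt e, tel⟩


/-- **Cor 5.5 (ii), the generators of `ℋ_{An•}` PINNED**: for a telecore `T` (edges `J`, functors `T.telMap`) over the core of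
(i) and a family of homotopies `ℋ` on `D_{An•}`: the boundary set of `ℋ` is generated (Def 3.5 (ii)) by the pairs
`([φ_□], [id_⋎] ∘ [φ_⋎])` (both orders; homotopy `η_{□⋎}` = the identity, componentwise) and, for each `⋏ ∈ L ∪ {□}` and each
telecore edge `φ_⋏`, the pairs `([β¹_⋏], [β⁰_⋏])` (both orders) for SOME descending path (a choice of `v`, `ν`), with homotopy
`η_⋏` = "the isomorphism arising from `η_{An•}`" componentwise — i.e. `φ_{An•} κ_{An•}(λ⊞_{v,ν} lies over Th•[Z]) ≫ η_{An•}`.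
[cite: MochizukiAbsTopIII2015, Cor 5.5 (ii) p. 131] -/
def IsAnContactGenerated {H hH}
    {hc : (DiagramOfCategories.Observable.mk (obsShape (InFive (isArc := isArc)) DVertex.an)
      (fun _ => (inferInstance : IsEmpty PEmpty.{u + 1})) (Lt.obsExt InFive .an) H hH).IsCore}
    (T : DiagramOfCategories.Telecore _ _ hc) (Hc : (Lt.anTelecoreDiagram T.J T.telMap).HomotopyFamily) : Prop :=
  ∃ (vc : Vmod) (νc : LogVertex (isArc vc)) (hνc : νc.isPostLog = false)
    (vr : ℤ → Vmod) (νr : ∀ n, LogVertex (isArc (vr n))) (hνr : ∀ n, (νr n).isPostLog = false),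
    -- generation of the boundary set
    DiagramOfCategories.HomotopyFamily.IsGeneratedBy _ Hc (fun ⦃a b⦄ p q =>
      (∃ (n : ℤ) (jc : T.J ⟨.core, core_mem_five⟩) (jn : T.J ⟨.row1 n, row1_mem_five n⟩) (_ : a = (anTelecoreShape T.J).obs)
          (_ : b = (anTelecoreShape T.J).base ⟨.core, core_mem_five⟩),
        (HEq p (phiCorePath T.J jc) ∧ HEq q (phiRowPath T.J n jn)) ∨
          (HEq p (phiRowPath T.J n jn) ∧ HEq q (phiCorePath T.J jc))) ∨
      (∃ (jc : T.J ⟨.core, core_mem_five⟩) (_ : a = (anTelecoreShape T.J).base ⟨.core, core_mem_five⟩) (_ : b = a),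
        (HEq p (betaCorePath T.J vc νc hνc jc) ∧ HEq q (Path.nil : Path a a)) ∨
          (HEq p (Path.nil : Path a a) ∧ HEq q (betaCorePath T.J vc νc hνc jc))) ∨
      (∃ (n : ℤ) (jn : T.J ⟨.row1 n, row1_mem_five n⟩) (_ : a = (anTelecoreShape T.J).base ⟨.row1 n, row1_mem_five n⟩)
          (_ : b = a),
        (HEq p (betaRowPath T.J n (vr n) (νr n) (hνr n) jn) ∧ HEq q (Path.nil : Path a a)) ∨
          (HEq p (Path.nil : Path a a) ∧ HEq q (betaRowPath T.J n (vr n) (νr n) (hνr n) jn)))) ∧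
    -- `η_{□⋎}` is the identity natural transformation (componentwise)
    (∀ (n : ℤ) (jc : T.J ⟨.core, core_mem_five⟩) (jn : T.J ⟨.row1 n, row1_mem_five n⟩)
        (hmem : Hc.E (phiCorePath T.J jc) (phiRowPath T.J n jn)) (A : Lt.An),
      ∃ h, (Hc.η hmem).app A = eqToHom h) ∧
    -- `η_□` arises from `η_{An•}` (componentwise)
    (∀ (jc : T.J ⟨.core, core_mem_five⟩) (hmem : Hc.E (betaCorePath T.J vc νc hνc jc) Path.nil) (X₀ : Lt.X),
      ∃ (h₁ : ((Lt.anTelecoreDiagram T.J T.telMap).pathFunctor (betaCorePath T.J vc νc hνc jc)).obj X₀ =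
          Lt.φAn.obj (Lt.κAn.functor.obj ((Lt.lam vc νc ⋙ Lt.forget vc ⋙ Lt.toE vc).obj X₀)))
        (h₂ : X₀ = ((Lt.anTelecoreDiagram T.J T.telMap).pathFunctor (Path.nil :
          Path ((anTelecoreShape T.J).base ⟨.core, core_mem_five⟩) _)).obj X₀),
        (Hc.η hmem).app X₀ =
          eqToHom h₁ ≫ Lt.φAn.map (Lt.κAn.functor.map ((Lt.lamOver vc νc).hom.app X₀)) ≫ Lt.ηAn.hom.app X₀ ≫ eqToHom h₂) ∧
    -- `η_⋎` arises from `η_{An•}` (componentwise)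
    (∀ (n : ℤ) (jn : T.J ⟨.row1 n, row1_mem_five n⟩)
        (hmem : Hc.E (betaRowPath T.J n (vr n) (νr n) (hνr n) jn) Path.nil) (X₀ : Lt.X),
      ∃ (h₁ : ((Lt.anTelecoreDiagram T.J T.telMap).pathFunctor (betaRowPath T.J n (vr n) (νr n) (hνr n) jn)).obj X₀ =
          Lt.φAn.obj (Lt.κAn.functor.obj ((Lt.lam (vr n) (νr n) ⋙ Lt.forget (vr n) ⋙ Lt.toE (vr n)).obj X₀)))
        (h₂ : X₀ = ((Lt.anTelecoreDiagram T.J T.telMap).pathFunctor (Path.nil :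
          Path ((anTelecoreShape T.J).base ⟨.row1 n, row1_mem_five n⟩) _)).obj X₀),
        (Hc.η hmem).app X₀ =
          eqToHom h₁ ≫ Lt.φAn.map (Lt.κAn.functor.map ((Lt.lamOver (vr n) (νr n)).hom.app X₀)) ≫ Lt.ηAn.hom.app X₀ ≫
            eqToHom h₂)

/-- **Cor 5.5 (ii) with the contact structure PINNED** (assumption on `L`): `φ_{An•}` gives a telecore `𝔗_{An•}` on `D•_{≤5}`
over the core `An•[𝒳]` of (i), with telecore edges `φ_⋏ = φ_{An•}` (`⋏ ∈ L ∪ {□}`), and "the collection of natural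
transformations `{η_{□⋎}, η_{□⋎}⁻¹, η_⋏, η_⋏⁻¹}` … generate a contact structure `ℋ_{An•}` on the telecore `𝔗_{An•}`".
[cite: MochizukiAbsTopIII2015, Cor 5.5 (ii) pp. 130–131] -/
def Cor55TelecoreContact : Prop :=
  ∃ (H : ((Lt.subdiagram (InFive (isArc := isArc))).extend (Lt.obsExt InFive .an)).HomotopyFamily)
    (hH : ∀ ⦃a b : (obsShape (InFive (isArc := isArc)) DVertex.an).Vertex⦄ ⦃p q : Path a b⦄,
      H.E p q → b = (obsShape (InFive (isArc := isArc)) DVertex.an).obs)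
    (hc : (DiagramOfCategories.Observable.mk _ (fun _ => (inferInstance : IsEmpty PEmpty.{u + 1})) _ H hH).IsCore)
    (T : DiagramOfCategories.Telecore _ _ hc),
    T.J = (fun a => TelecoreIdx a.1) ∧
      HEq (fun (a : DSub (InFive (isArc := isArc))) (j : T.J a) => T.telMap j)
        (fun (a : DSub (InFive (isArc := isArc))) (j : TelecoreIdx a.1) => Lt.telecoreFun a.1 j) ∧
      ∃ Hc, DiagramOfCategories.Telecore.IsContactStructure _ T Hc ∧ Lt.IsAnContactGenerated T Hc

/-- the pinned form refines `Cor55Telecore` of `LogFrobeniusCorollaries.lean`. [cite: MochizukiAbsTopIII2015, Cor 5.5 (ii) p. 131] -/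
theorem cor55Telecore_of_contact (h : Lt.Cor55TelecoreContact) : Lt.Cor55Telecore := by
  obtain ⟨H, hH, hc, T, hJ, htel, Hc, hHc, -⟩ := h
  exact ⟨H, hH, hc, T, hJ, htel, Hc, hHc⟩

end LogFrobeniusSettingLtimes

end Literature.AnabelianGeometry.AbsoluteAnabelian
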